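import Summits.ResolutionOfSingularities.ResolutionOfSingularities.Theses.AbhyankarShadows
import Summits.ResolutionOfSingularities.ResolutionOfSingularities.Theorems.ValuativeLuAlphaPTorsorAPTorsion
import Mathlib.NumberTheory.FrobeniusNumber

/-!
# `ShadowsUniformize` — negative lemmas I: irrefutability and the identity-shadow locus

Support (negative) lemmas for the crux `stmt-ResolutionOfSingularities-16756`
(`Summit.ResolutionOfSingularities.ResolutionOfSingularities.Theses.AbhyankarShadows.ShadowsUniformize`,
route AbhyankarShadows, crux #2 = the TRANSFER half of Teissier's semivaluation conjecture,
arXiv:2311.12456 p. 5, as typed by the planner):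

  `k` algebraically closed of characteristic `p`, `K/k` finitely generated, `O` a RATIONAL valuation
  ring of `K/k`, `R ⊆ O` finitely generated; IF every finite `F ⊆ R` admits a SHADOW of `(R, O)`
  exact on `F` — clauses [rank] [inside] [centre] [rational'] [fg] and an embedding `ι` with [inj]
  [values] [exact] — THEN some finitely generated `A`, `R ≤ A ⊆ O`, `Frac A = K`, is regular at the
  centre of `O` (the conclusion of the route's target `LurelRational`, verbatim).

Filed by the standing disprover (cdisprove, cycle 1; work file `Cruxes/ShadowsUniformize/Disproof.lean`;
companion file `Negative/LoadBearing.lean` treats the load-bearing clauses [fg] / [exact]).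
The file declares NO definition: every clause is written out inline.

## Findings (all sorry-free)

* §0 `not_lurelRational_of_not_shadowsUniformize` — the crux is the target with one extra
  hypothesis (`LurelRational → ShadowsUniformize`, recorded contrapositively). A refutation of the
  crux is a refutation of relative local uniformization at a rational place over an algebraically
  closed field, i.e. of the summit's valuation-theoretic core; the crux is NOT independently
  falsifiable (the route's kill criterion "shadows exist but no finite `F` transfers" speaks about
  the toric MECHANISM, which the typed statement does not mention).
* §1 helpers: `exists_fg_isFractionRing_le` (a finitely generated `R ⊆ O` enlarges inside `O` to a
  finitely generated `R₁` with `Frac R₁ = K`, by adjoining `z` or `z⁻¹` for the field generators —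
  the "local blowing up" slot of the shadow clause, filled for free), `residueConstant_unique` (the residue constant at a rational place is unique; constants are units,
  tree `PfaffLine.ap_valuation_algebraMap_eq_one`).
* §2 THE IDENTITY-SHADOW LOCUS. `shadow_of_fg_semigroup`: whenever the value semigroup
  `ν(R₁ ∖ 0) ∪ {0}` of a model `R₁ ⊇ R` with `Frac R₁ = K` is finitely generated, the IDENTITY
  (`L = K`, `φ = R₁ ↪ K`, `O' = O`, `ι = id`) is a shadow exact on EVERY `F` — all eight clauses hold
  by `rfl`. `submonoid_fg_of_isCyclic_units` + `semigroup_fg_of_isCyclic_valueGroup`: if the value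
  group of `O` is cyclic (a discrete rank-one place) the semigroup of EVERY `R₁ ⊆ O` is finitely
  generated (numerical semigroups; Mathlib `Nat.addSubmonoid_fg`). Hence
  `hasShadows_of_isCyclic_valueGroup`: at every rational place with value group `ℤ` the shadow
  hypothesis holds for every finitely generated `R ⊆ O` with NO input, and
  `lurel_of_shadowsUniformize_of_isCyclic_valueGroup`: the crux CONTAINS relative local
  uniformization at all discrete rational places of function fields over algebraically closed fields
  of characteristic `p` (any dimension), with the toric engine idle (`gr_ν R₁ = k[t^S]`, `S ⊆ ℕ`).
  Such places are non-Abhyankar as soon as `trdeg K ≥ 2` (arc valuations through transcendental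
  formal curves); local uniformization there is KNOWN but deep and absent from the tree: `K` lies in
  the completion `k((t))` of the Abhyankar subfield `k(t)` (`t` a uniformizer: every element of `O`
  is a constant plus `t` times an element of `O`), so Knaf–Kuhlmann 2009, Thm. 1.5 (arXiv:math/0702856
  p. 5, "`(F,P)` lies in the completion of a subfunction field `(F₀,P|F₀)` such that `P|F₀` is an
  Abhyankar place … then `P` is strongly smoothly `K`-uniformizable") applies.
  `lurel_of_shadowsUniformize_of_fg_semigroup` is the general form (any `R` with `Frac R = K` and
  finitely generated semigroup: Abhyankar places after a modification — the known case — but also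
  `ν(x)=1, ν(y)=√2, z ↦` a convergent generalized power series on `k[x,y,z]`, rational rank `2 < 3`).

## Sources
* B. Teissier, arXiv:2311.12456 (LNM 2313, 2023), p. 5 (the conjecture).
* H. Knaf, F.-V. Kuhlmann, *Every place admits local uniformization in a finite extension of the
  function field*, Adv. Math. 221 (2009) = arXiv:math/0702856, Thm. 1.5 (p. 5), Prop. 3.11 (p. 14).
* Mathlib `Nat.addSubmonoid_fg` (every submonoid of `ℕ` is finitely generated).
-/

noncomputable section

open Summit.ResolutionOfSingularities.ResolutionOfSingularities.Theses.AbhyankarShadows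

set_option linter.dupNamespace false -- mandated namespace of this single-conjunct summit

namespace Summit.ResolutionOfSingularities.ResolutionOfSingularities.Theorems.ShadowsUniformize.Negative

/-! ## §0 Irrefutability: the crux is the target plus one hypothesis -/

/-- **`¬ ShadowsUniformize → ¬ LurelRational`**: the crux is the route's target weakened by the
shadow hypothesis (drop it: `LurelRational → ShadowsUniformize`, stated here contrapositively), so
a refutation of the crux is a refutation of relative local uniformization at a rational place over
an algebraically closed field — the crux is not independently falsifiable. [folklore] -/
theorem not_lurelRational_of_not_shadowsUniformize : ¬ ShadowsUniformize → ¬ LurelRational :=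
  fun hn h => hn fun p hp k K _ _ _ _ _ hfg O hO hrat R hR hRO _ => h p hp k K hfg O hO hrat R hR hRO

/-! ## §1 Helpers -/

section Helpers

variable {k K : Type} [Field k] [Field K] [Algebra k K]

/-- **Birational enlargement inside `O`**: if `K/k` is finitely generated and `O ∋ k` is a valuation
ring of `K`, every finitely generated `R ⊆ O` is contained in a finitely generated `R₁ ⊆ O` with
`Frac R₁ = K` (adjoin each field generator `z` if `z ∈ O`, else `z⁻¹ ∈ O`). This is the "local
blowing up `R ≤ R₁`" slot of the shadow clause, filled for free. [folklore] -/
theorem exists_fg_isFractionRing_le (hKfg : (⊤ : IntermediateField k K).FG) (O : ValuationSubring K)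
    (hk : ∀ c : k, algebraMap k K c ∈ O)
    (R : Subalgebra k K) (hR : R.FG) (hRO : R.toSubring ≤ O.toSubring) :
    ∃ R₁ : Subalgebra k K, R ≤ R₁ ∧ R₁.toSubring ≤ O.toSubring ∧ R₁.FG ∧ IsFractionRing R₁ K := by
  classical
  obtain ⟨s, hs⟩ := hKfg
  obtain ⟨t, ht⟩ := hR
  let s' : Finset K := s.image fun z => if z ∈ O then z else z⁻¹
  have hs'O : ∀ z ∈ s', z ∈ O := by
    intro z hz
    obtain ⟨w, -, rfl⟩ := Finset.mem_image.mp hz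
    by_cases hw : w ∈ O
    · simp [hw]
    · simpa [hw] using (O.mem_or_inv_mem w).resolve_left hw
  let Ok : Subalgebra k K :=
    { O.toSubring.toSubsemiring with
      algebraMap_mem' := fun c => hk c }
  have hOk : ∀ z : K, z ∈ Ok ↔ z ∈ O := fun z => Iff.rfl
  refine ⟨Algebra.adjoin k ((t : Set K) ∪ (s' : Set K)), ?_, ?_, ⟨t ∪ s', by simp⟩, ?_⟩
  · rw [← ht]
    exact Algebra.adjoin_mono Set.subset_union_left
  · have : Algebra.adjoin k ((t : Set K) ∪ (s' : Set K)) ≤ Ok := by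
      refine Algebra.adjoin_le ?_
      rintro z (hz | hz)
      · exact (hOk z).mpr (hRO (ht ▸ Algebra.subset_adjoin hz))
      · exact (hOk z).mpr (hs'O z hz)
    intro z hz
    exact this hz
  · set R₁ := Algebra.adjoin k ((t : Set K) ∪ (s' : Set K)) with hR₁
    have hsub : Subfield.closure (Set.range (algebraMap k K) ∪ (s : Set K)) ≤
        Subfield.closure (R₁ : Set K) := by
      refine Subfield.closure_le.mpr ?_
      rintro z (⟨c, rfl⟩ | hz)
      · exact Subfield.subset_closure (R₁.algebraMap_mem c)
      · by_cases hzO : z ∈ O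
        · refine Subfield.subset_closure (Algebra.subset_adjoin (Or.inr ?_))
          exact Finset.mem_coe.mpr (Finset.mem_image.mpr ⟨z, hz, by simp [hzO]⟩)
        · have hz' : z⁻¹ ∈ (R₁ : Set K) := Algebra.subset_adjoin (Or.inr
            (Finset.mem_coe.mpr (Finset.mem_image.mpr ⟨z, hz, by simp [hzO]⟩)))
          rw [← inv_inv z]
          exact inv_mem (Subfield.subset_closure hz')
    refine IsFractionRing.of_field R₁ K fun z => ?_
    have hz : z ∈ Subfield.closure (R₁ : Set K) := by
      apply hsub
      have : z ∈ IntermediateField.adjoin k (s : Set K) := by rw [hs]; trivial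
      exact this
    rw [Subfield.mem_closure_iff] at hz
    obtain ⟨a, ha, b, hb, rfl⟩ := hz
    have hcl' : Subring.closure (R₁ : Set K) = R₁.toSubring := by
      rw [← Subalgebra.coe_toSubring, Subring.closure_eq]
    rw [hcl'] at ha hb
    exact ⟨⟨a, ha⟩, ⟨b, hb⟩, rfl⟩

/-- **Uniqueness of the residue constant**: two constants congruent to the same `x` modulo the
maximal ideal of `O ⊇ k` coincide. [folklore] -/
theorem residueConstant_unique (O : ValuationSubring K) (hk : ∀ c : k, algebraMap k K c ∈ O)
    {x : K} {c c' : k} (h : O.valuation (x - algebraMap k K c) < 1)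
    (h' : O.valuation (x - algebraMap k K c') < 1) : c = c' := by
  by_contra hne
  have hlt : O.valuation (algebraMap k K (c' - c)) < 1 := by
    have : algebraMap k K (c' - c) = (x - algebraMap k K c) - (x - algebraMap k K c') := by
      rw [map_sub]; ring
    rw [this]
    exact Valuation.map_sub_lt _ h h'
  have h1 := PfaffLine.ap_valuation_algebraMap_eq_one O hk (sub_ne_zero.mpr (Ne.symm hne))
  rw [h1] at hlt
  exact lt_irrefl _ hlt

end Helpers

/-! ## §2 The identity-shadow locus: finitely generated value semigroup, e.g. value group `ℤ` -/

section IdentityShadow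

variable {k K : Type} [Field k] [Field K] [Algebra k K]

/-- **The identity shadow.** If `R ≤ R₁ ⊆ O`, `R₁` finitely generated with `Frac R₁ = K`, has
FINITELY GENERATED value semigroup `ν(R₁ ∖ 0) ∪ {0}`, then for every finite `F ⊆ R` the data
`L := K`, `φ := (R₁ ↪ K)`, `O' := O`, `ι := id` satisfy ALL eight shadow clauses of the crux (each
by `rfl`): the shadow hypothesis asks nothing of `ν` beyond `R₁`'s semigroup. No algebraic
closedness, characteristic or finite generation of `K/k` is used. [folklore] -/
theorem shadow_of_fg_semigroup (O : ValuationSubring K)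
    (hrat : ∀ x : K, x ∈ O → ∃ c : k, O.valuation (x - algebraMap k K c) < 1)
    (R : Subalgebra k K) (F : Finset R) (R₁ : Subalgebra k K) (hle : R ≤ R₁)
    (hR₁O : R₁.toSubring ≤ O.toSubring) (hR₁ : R₁.FG) (hfrac : IsFractionRing R₁ K)
    (hfg : (MonoidHom.mrange (O.valuation.toMonoidWithZeroHom.toMonoidHom.comp
      R₁.val.toRingHom.toMonoidHom)).FG) :
    ∃ (R₁ : Subalgebra k K) (hle : R ≤ R₁) (_ : R₁.toSubring ≤ O.toSubring),
    R₁.FG ∧ IsFractionRing R₁ K ∧ ∃ (L : Type) (_ : Field L) (_ : Algebra k L) (φ : R₁ →ₐ[k] L)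
    (O' : ValuationSubring L), Module.finrank ℤ (Additive (O'.ValueGroup)ˣ) =
      Module.finrank ℤ (Additive (O.ValueGroup)ˣ) ∧ (∀ y : R₁, φ y ∈ O') ∧
    (∀ y : R₁, O'.valuation (φ y) < 1 ↔ O.valuation (y : K) < 1) ∧
    (∀ z : L, z ∈ O' → ∃ c : k, O'.valuation (z - algebraMap k L c) < 1) ∧
    (MonoidHom.mrange (O'.valuation.toMonoidWithZeroHom.toMonoidHom.comp
      φ.toRingHom.toMonoidHom)).FG ∧
    ∃ ι : O'.ValueGroup →*₀o O.ValueGroup, Function.Injective ι ∧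
      (∀ y : R₁, φ y ≠ 0 → ∃ y' : R₁, ι (O'.valuation (φ y)) = O.valuation (y' : K)) ∧
      ∀ x ∈ F, ι (O'.valuation (φ (Subalgebra.inclusion hle x))) = O.valuation ((x : R) : K) :=
  ⟨R₁, hle, hR₁O, hR₁, hfrac, K, inferInstance, inferInstance, R₁.val, O, rfl,
    fun y => hR₁O y.2, fun _ => Iff.rfl, hrat, hfg, OrderMonoidWithZeroHom.id _,
    fun _ _ h => h, fun y _ => ⟨y, rfl⟩, fun _ _ => rfl⟩

/-- **Numerical semigroups inside a discrete value group are finitely generated**: in a linearly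
ordered commutative group with zero whose group of units is cyclic, every submonoid consisting of
elements `≤ 1` is finitely generated (pull back along `n ↦ gⁿ` for the generator `g ≤ 1` and use
that every submonoid of `ℕ` is finitely generated, Mathlib `Nat.addSubmonoid_fg`). [folklore] -/
theorem submonoid_fg_of_isCyclic_units {Γ₀ : Type*} [LinearOrderedCommGroupWithZero Γ₀]
    [IsCyclic Γ₀ˣ] (M : Submonoid Γ₀) (hM : ∀ x ∈ M, x ≤ 1) : M.FG := by
  classical
  -- a generator `g ≤ 1` of the units, and `u ≤ 1 ⇒ u = g ^ n` for some `n : ℕ`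
  obtain ⟨g, hg⟩ : ∃ g : Γ₀ˣ, (g : Γ₀) ≤ 1 ∧
      ∀ u : Γ₀ˣ, (u : Γ₀) ≤ 1 → ∃ n : ℕ, (g : Γ₀) ^ n = u := by
    obtain ⟨g₀, hg₀⟩ := IsCyclic.exists_generator (α := Γ₀ˣ)
    rcases le_total (g₀ : Γ₀) 1 with hle | hle
    · refine ⟨g₀, hle, fun u hu => ?_⟩
      obtain ⟨m, rfl⟩ := Subgroup.mem_zpowers_iff.mp (hg₀ u)
      rcases Int.eq_nat_or_neg m with ⟨n, rfl | rfl⟩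
      · exact ⟨n, by simp⟩
      · refine ⟨0, ?_⟩
        have h1 : ((g₀ ^ (n : ℤ))⁻¹ : Γ₀ˣ) = g₀ ^ (-(n : ℤ)) := by rw [zpow_neg]
        have hpow : ((g₀ : Γ₀) ^ n) ≤ 1 := pow_le_one' hle n
        have hu' : ((g₀ ^ (-(n : ℤ)) : Γ₀ˣ) : Γ₀) = ((g₀ : Γ₀) ^ n)⁻¹ := by
          rw [← h1]; simp
        rw [hu'] at hu ⊢
        have h0 : (0 : Γ₀) < (g₀ : Γ₀) ^ n := zero_lt_iff.mpr (pow_ne_zero n g₀.ne_zero)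
        have : (g₀ : Γ₀) ^ n = 1 := le_antisymm hpow ((inv_le_one₀ h0).mp hu)
        simp [this]
    · refine ⟨g₀⁻¹, by simpa using inv_le_one_of_one_le₀ hle, fun u hu => ?_⟩
      obtain ⟨m, rfl⟩ := Subgroup.mem_zpowers_iff.mp (hg₀ u)
      rcases Int.eq_nat_or_neg m with ⟨n, rfl | rfl⟩
      · refine ⟨0, ?_⟩
        have hpow : 1 ≤ ((g₀ : Γ₀) ^ n) := one_le_pow_of_one_le' hle n
        have hu' : ((g₀ ^ (n : ℤ) : Γ₀ˣ) : Γ₀) = (g₀ : Γ₀) ^ n := by simp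
        rw [hu'] at hu ⊢
        have : (g₀ : Γ₀) ^ n = 1 := le_antisymm hu hpow
        simp [this]
      · refine ⟨n, ?_⟩
        simp [zpow_neg, inv_pow]
  -- pull back along `n ↦ g ^ n`
  let f : Multiplicative ℕ →* Γ₀ := powersHom Γ₀ (g : Γ₀)
  let N : Submonoid (Multiplicative ℕ) := M.comap f
  have hN : N.FG := by
    have := Nat.addSubmonoid_fg (AddSubmonoid.toSubmonoid.symm N)
    rw [AddSubmonoid.fg_iff_mul_fg] at this
    simpa using this
  obtain ⟨T, hT⟩ := hN
  refine (Submonoid.fg_iff M).mpr ⟨f '' (T : Set (Multiplicative ℕ)) ∪ ({0} ∩ (M : Set Γ₀)),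
    ?_, (T.finite_toSet.image f).union ((Set.finite_singleton 0).inter_of_left _)⟩
  apply le_antisymm
  · refine Submonoid.closure_le.mpr ?_
    rintro x (⟨n, hn, rfl⟩ | ⟨-, hx⟩)
    · have : n ∈ N := hT ▸ Submonoid.subset_closure hn
      exact this
    · exact hx
  · intro x hx
    by_cases hx0 : x = 0
    · exact Submonoid.subset_closure (Or.inr ⟨hx0, hx⟩)
    · obtain ⟨n, hn⟩ := hg.2 (Units.mk0 x hx0) (by simpa using hM x hx)
      have hfn : f (Multiplicative.ofAdd n) = x := by simpa [f] using hn
      have hnN : Multiplicative.ofAdd n ∈ N := by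
        change f (Multiplicative.ofAdd n) ∈ M
        rwa [hfn]
      rw [← hT] at hnN
      have : f (Multiplicative.ofAdd n) ∈ Submonoid.map f (Submonoid.closure (T : Set _)) :=
        Submonoid.mem_map_of_mem f hnN
      rw [MonoidHom.map_mclosure] at this
      rw [← hfn]
      exact Submonoid.closure_mono Set.subset_union_left this

/-- **At a discrete rank-one place every model has a finitely generated value semigroup**: if the
value group of `O` is cyclic, the semigroup `ν(R₁ ∖ 0) ∪ {0}` of every subalgebra `R₁ ⊆ O` is
finitely generated (a numerical semigroup with zero) — whether or not `O` is Abhyankar.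
[folklore] -/
theorem semigroup_fg_of_isCyclic_valueGroup (O : ValuationSubring K)
    (hcyc : IsCyclic (O.ValueGroup)ˣ) (R₁ : Subalgebra k K) (hR₁O : R₁.toSubring ≤ O.toSubring) :
    (MonoidHom.mrange (O.valuation.toMonoidWithZeroHom.toMonoidHom.comp
      R₁.val.toRingHom.toMonoidHom)).FG := by
  haveI := hcyc
  refine submonoid_fg_of_isCyclic_units _ ?_
  rintro x ⟨y, rfl⟩
  exact (O.valuation_le_one_iff _).mpr (hR₁O y.2)

/-- **The shadow hypothesis is free at discrete rational places.** For `K/k` finitely generated,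
`O ∋ k` a rational valuation ring of `K` with CYCLIC value group and `R ⊆ O` finitely generated,
every finite `F ⊆ R` admits a shadow exact on `F` — verbatim the hypothesis of the crux — namely
the identity shadow on a birational enlargement `R₁ ⊇ R`. No algebraic closedness or
characteristic hypothesis is used. [folklore] -/
theorem hasShadows_of_isCyclic_valueGroup (hKfg : (⊤ : IntermediateField k K).FG)
    (O : ValuationSubring K) (hk : ∀ c : k, algebraMap k K c ∈ O)
    (hrat : ∀ x : K, x ∈ O → ∃ c : k, O.valuation (x - algebraMap k K c) < 1)
    (hcyc : IsCyclic (O.ValueGroup)ˣ)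
    (R : Subalgebra k K) (hR : R.FG) (hRO : R.toSubring ≤ O.toSubring) :
    ∀ F : Finset R, ∃ (R₁ : Subalgebra k K) (hle : R ≤ R₁) (_ : R₁.toSubring ≤ O.toSubring),
    R₁.FG ∧ IsFractionRing R₁ K ∧ ∃ (L : Type) (_ : Field L) (_ : Algebra k L) (φ : R₁ →ₐ[k] L)
    (O' : ValuationSubring L), Module.finrank ℤ (Additive (O'.ValueGroup)ˣ) =
      Module.finrank ℤ (Additive (O.ValueGroup)ˣ) ∧ (∀ y : R₁, φ y ∈ O') ∧
    (∀ y : R₁, O'.valuation (φ y) < 1 ↔ O.valuation (y : K) < 1) ∧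
    (∀ z : L, z ∈ O' → ∃ c : k, O'.valuation (z - algebraMap k L c) < 1) ∧
    (MonoidHom.mrange (O'.valuation.toMonoidWithZeroHom.toMonoidHom.comp
      φ.toRingHom.toMonoidHom)).FG ∧
    ∃ ι : O'.ValueGroup →*₀o O.ValueGroup, Function.Injective ι ∧
      (∀ y : R₁, φ y ≠ 0 → ∃ y' : R₁, ι (O'.valuation (φ y)) = O.valuation (y' : K)) ∧
      ∀ x ∈ F, ι (O'.valuation (φ (Subalgebra.inclusion hle x))) = O.valuation ((x : R) : K) := by
  intro F
  obtain ⟨R₁, hle, hR₁O, hR₁, hfrac⟩ := exists_fg_isFractionRing_le hKfg O hk R hR hRO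
  exact shadow_of_fg_semigroup O hrat R F R₁ hle hR₁O hR₁ hfrac
    (semigroup_fg_of_isCyclic_valueGroup O hcyc R₁ hR₁O)

/-- **The crux contains local uniformization at all discrete rational places.** `ShadowsUniformize`
implies, with its shadow hypothesis discharged for free by the identity shadow, relative local
uniformization at every rational valuation ring with value group `ℤ` of every finitely generated
`K/k`, `k` algebraically closed of characteristic `p`, in every dimension. Such places are
non-Abhyankar for `trdeg K ≥ 2`; the statement is true (Knaf–Kuhlmann 2009, Thm. 1.5: `K` lies in
the completion `k((t))` of the Abhyankar subfield `k(t)`) but is a deep theorem absent from the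
tree — a lower bound for the difficulty of ANY proof of the crux, on a locus where the toric
transfer mechanism receives no information. [folklore] -/
theorem lurel_of_shadowsUniformize_of_isCyclic_valueGroup (h : ShadowsUniformize)
    (p : ℕ) (hp : p.Prime) (k K : Type) [Field k] [CharP k p] [IsAlgClosed k] [Field K]
    [Algebra k K] (hKfg : (⊤ : IntermediateField k K).FG)
    (O : ValuationSubring K) (hk : ∀ c : k, algebraMap k K c ∈ O)
    (hrat : ∀ x : K, x ∈ O → ∃ c : k, O.valuation (x - algebraMap k K c) < 1)
    (hcyc : IsCyclic (O.ValueGroup)ˣ)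
    (R : Subalgebra k K) (hR : R.FG) (hRO : R.toSubring ≤ O.toSubring) :
    ∃ (A : Subalgebra k K) (hA : A.toSubring ≤ O.toSubring), R ≤ A ∧ A.FG ∧ IsFractionRing A K ∧
      IsRegularLocalRing
        (Localization.AtPrime (Ideal.comap (Subring.inclusion hA) (IsLocalRing.maximalIdeal O))) :=
  h p hp k K hKfg O hk hrat R hR hRO (hasShadows_of_isCyclic_valueGroup hKfg O hk hrat hcyc R hR hRO)

/-- **General form of the loophole**: `ShadowsUniformize` implies relative local uniformization at
`(O, R)` for every finitely generated `R ⊆ O` with `Frac R = K` whose value semigroup is finitely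
generated — the identity shadow at `R₁ = R` serves every `F`. This class contains every Abhyankar
place after a modification (the KNOWN case, Knaf–Kuhlmann 2005 Thm. 1.1, in tree) but also
non-Abhyankar ones (value group `ℤ`; or `ν(x) = 1`, `ν(y) = √2`, `z ↦` a convergent generalized
power series in `x, y` on `k[x, y, z]`, rational rank `2 < 3`). [folklore] -/
theorem lurel_of_shadowsUniformize_of_fg_semigroup (h : ShadowsUniformize)
    (p : ℕ) (hp : p.Prime) (k K : Type) [Field k] [CharP k p] [IsAlgClosed k] [Field K]
    [Algebra k K] (hKfg : (⊤ : IntermediateField k K).FG)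
    (O : ValuationSubring K) (hk : ∀ c : k, algebraMap k K c ∈ O)
    (hrat : ∀ x : K, x ∈ O → ∃ c : k, O.valuation (x - algebraMap k K c) < 1)
    (R : Subalgebra k K) (hR : R.FG) (hRO : R.toSubring ≤ O.toSubring) (hfrac : IsFractionRing R K)
    (hfg : (MonoidHom.mrange (O.valuation.toMonoidWithZeroHom.toMonoidHom.comp
      R.val.toRingHom.toMonoidHom)).FG) :
    ∃ (A : Subalgebra k K) (hA : A.toSubring ≤ O.toSubring), R ≤ A ∧ A.FG ∧ IsFractionRing A K ∧
      IsRegularLocalRing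
        (Localization.AtPrime (Ideal.comap (Subring.inclusion hA) (IsLocalRing.maximalIdeal O))) :=
  h p hp k K hKfg O hk hrat R hR hRO fun F =>
    shadow_of_fg_semigroup O hrat R F R le_rfl hRO hR hfrac hfg

end IdentityShadow

end Summit.ResolutionOfSingularities.ResolutionOfSingularities.Theorems.ShadowsUniformize.Negative

end
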